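import Mathlib.NumberTheory.Padics.HeightOneSpectrum
import Summits.BirchSwinnertonDyer.BirchSwinnertonDyer.Theorems.SignedLowerHalvesSmallImageLowerHalfBothSignsRttE2NumHeadline
import Summits.BirchSwinnertonDyer.Rank1Residual.X2.EulerFactorAlgebra
import HarnessLib

/-!
# Route `SignedLowerHalves`, crux L `SmallImageLowerHalfBothSigns` (item stmt-BirchSwinnertonDyer-23599), line `rtt_w3` — row E2-num, part 7:
# the headline PRE-INSTANTIATED at the crux's places — `u_v = ℓ_v⁻¹`, `f_v = frobeniusExponent p ℓ_v` for `v = (ℓ_v) ∈ S₀`, `ℓ_v ≠ p`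
# (the side conditions `u_v ≠ 0`, `f_v ≠ 0` of p775021 discharged once and for all)

Width seat `bsd-line-slh-p3-w3` g19 under LEAD `cruxlead-stmt-BirchSwinnertonDyer-23599` g9 (cell `bsd-ssimc`); ROUTE-INDEPENDENT helper
(`--supports stmt-BirchSwinnertonDyer-23599`); THEOREMS ONLY — no definition, no named fact, no instance, no `sorry`; closes nothing; BSD is not proved
by any of this.

WHY. The LEAD's E2 glue `charRoad_E2_of_parts` consumes p775021's `lambdaInvariant_quotient_span_eq_of_eulerProduct_iwasawaAlgebraO` «hypothesis
VERBATIM» (bus 13:35:07Z); at the crux's places `v ∈ S₀ ⊂` primes of `ℚ` with `ℓ_v = natGenerator v ≠ p` the generic side conditions are automatic: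
`(ℓ_v : ℚ̄_p)⁻¹ ≠ 0` and `frobeniusExponent p ℓ_v ≠ 0` (`X2.EulerFactorAlgebra.frobeniusExponent_natCast_ne_zero`: `ℓ_v` is a `p`-adic unit `> 1`,
so `γ^{f_ℓ} = ⟨ℓ⟩ ≠ 1`). This file restates the headline with those instantiated, leaving only `P_v ≠ 0` (for the E2-tail's
`P_v = 1 − C (embCoeff g ι ℓ_v) X + c_v X²` this is `P_v(0) = 1 ≠ 0`, one `simp` for the consumer).

* `inv_natCast_natGenerator_ne_zero`, `frobeniusExponent_natGenerator_ne_zero` (for `natGenerator v ≠ p`).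
* ★★ **`lambdaInvariant_quotient_span_eq_of_eulerProduct_places`** — p775021's headline on `IwasawaAlgebraO S` with `u_v = (ℓ_v : ℚ̄_p)⁻¹`,
  `f_v = frobeniusExponent p ℓ_v`: under `hf : iwasawaOToPowerSeries S f = C c · L · ∏_{v∈S₀} P_v(ℓ_v⁻¹·(1+T)^{f_{ℓ_v}})` the λ-invariant of `Λ_𝒪/(f)`
  (explicit `Module.compHom` structure along `PowerSeries.map ι₀`) is
  `[ℚ_p(S):ℚ_p]·(d + Σ_{v∈S₀} p^{(frobeniusExponent p ℓ_v).valuation}·layerLambda(P_v.comp (C ℓ_v⁻¹ * (X + 1))))` — the E2-tail's left side with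
  `P_v` the local polynomial.

References: [GreenbergVatsal2000] §1 p. 9, §2 Prop. (2.4); [Washington1997] §7.1, §13.2.
-/

set_option autoImplicit false
-- the Theorems namespace of this sub repeats the summit name by design (D-0017 nested layout)
set_option linter.dupNamespace false

noncomputable section

open PowerSeries Literature.NumberTheory.IwasawaTheory Literature.NumberTheory.EllipticCurves
  Literature.NumberTheory.EllipticCurves.GreenbergVatsal2000 IsDedekindDomain NumberField Rat.HeightOneSpectrum

namespace Summit.BirchSwinnertonDyer.BirchSwinnertonDyer.Theorems.SmallImageRttE2Num

variable {p : ℕ} [Fact p.Prime]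

/-- `(ℓ_v : ℚ̄_p)⁻¹ ≠ 0` for a finite place `v = (ℓ_v)` of `ℚ`. [folklore] -/
theorem inv_natCast_natGenerator_ne_zero (v : HeightOneSpectrum (𝓞 ℚ)) : ((natGenerator v : ℕ) : PadicAlgCl p)⁻¹ ≠ 0 :=
  inv_ne_zero (Nat.cast_ne_zero.mpr (prime_natGenerator v).ne_zero)

/-- `frobeniusExponent p ℓ_v ≠ 0` for a finite place `v = (ℓ_v)` of `ℚ` with `ℓ_v ≠ p` (`ℓ_v` is a `p`-adic unit `> 1`; `γ^{f_ℓ} = ⟨ℓ⟩ ≠ 1`).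
[cite: GreenbergVatsal2000, §1 p. 9] -/
theorem frobeniusExponent_natGenerator_ne_zero (v : HeightOneSpectrum (𝓞 ℚ)) (hv : natGenerator v ≠ p) :
    frobeniusExponent p ((natGenerator v : ℕ) : ℤ_[p]) ≠ 0 :=
  Summit.BirchSwinnertonDyer.Rank1Residual.X2.EulerFactorAlgebra.frobeniusExponent_natCast_ne_zero
    ((Nat.coprime_primes (Fact.out : p.Prime) (prime_natGenerator v)).mpr (Ne.symm hv)) (prime_natGenerator v).one_lt

/-- ★★ **E2-num headline at the crux's places.** For `𝒪 = padicCoeffIntegers S` (`[ℚ_p(S):ℚ_p] < ∞`), `Λ_𝒪 = IwasawaAlgebraO S`, a finite set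
`S₀` of finite places of `ℚ` away from `p`, non-zero local polynomials `P_v ∈ ℚ̄_p[X]`, `c ≠ 0`, `L ≠ 0` attaining its maximal coefficient norm
first at `d`, any `ι₀ : ℤ_p → 𝒪` compatible with `ℚ̄_p` (e.g. `padicIntToCoeffIntegers S`), and `f ∈ Λ_𝒪` with
`iwasawaOToPowerSeries S f = C c · L · ∏_{v∈S₀} P_v(ℓ_v⁻¹·(1+T)^{frobeniusExponent p ℓ_v})`: with the `Λ`-structure
`Module.compHom _ ((Ideal.Quotient.mk _).comp (PowerSeries.map ι₀))` on `Λ_𝒪/(f)`,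
`lambdaInvariant p (Λ_𝒪/(f)) = [ℚ_p(S):ℚ_p]·(d + Σ_{v∈S₀} p^{(frobeniusExponent p ℓ_v).valuation}·layerLambda(P_v.comp (C ℓ_v⁻¹ * (X + 1))))`.
[cite: GreenbergVatsal2000, §2 Prop. (2.4) and Cor. (2.3)] [cite: Washington1997, §7.1 Thm. 7.3 and §13.2] -/
theorem lambdaInvariant_quotient_span_eq_of_eulerProduct_places (S : Set (PadicAlgCl p))
    [FiniteDimensional ℚ_[p] (padicCoeffField S)] (S₀ : Finset (HeightOneSpectrum (𝓞 ℚ)))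
    (hS₀ : ∀ v ∈ S₀, natGenerator v ≠ p) {c : PadicAlgCl p} (hc : c ≠ 0) {L : PowerSeries (PadicAlgCl p)} (hL : L ≠ 0) {d : ℕ}
    (hle : ∀ k, ‖coeff k L‖ ≤ ‖coeff d L‖) (hlt : ∀ k, k < d → ‖coeff k L‖ < ‖coeff d L‖)
    (P : HeightOneSpectrum (𝓞 ℚ) → Polynomial (PadicAlgCl p)) (hP : ∀ v ∈ S₀, P v ≠ 0) :
    ∀ (ι₀ : ℤ_[p] →+* padicCoeffIntegers S),
      (∀ x : ℤ_[p], ((ι₀ x : padicCoeffIntegers S) : PadicAlgCl p) = algebraMap ℚ_[p] (PadicAlgCl p) (x : ℚ_[p])) →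
    ∀ f : IwasawaAlgebraO S,
      iwasawaOToPowerSeries S f = C c * L *
        ∏ v ∈ S₀, Polynomial.aeval (C ((natGenerator v : ℕ) : PadicAlgCl p)⁻¹ *
          (binomialSeries ℤ_[p] (frobeniusExponent p ((natGenerator v : ℕ) : ℤ_[p]))).map (algebraMap ℤ_[p] (PadicAlgCl p))) (P v) →
      @lambdaInvariant p _ (IwasawaAlgebraO S ⧸ Ideal.span {f}) _
          (Module.compHom (IwasawaAlgebraO S ⧸ Ideal.span {f})
            ((Ideal.Quotient.mk (Ideal.span {f})).comp (PowerSeries.map ι₀))) =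
        Module.finrank ℚ_[p] (padicCoeffField S) *
          (d + ∑ v ∈ S₀, p ^ (frobeniusExponent p ((natGenerator v : ℕ) : ℤ_[p])).valuation *
            layerLambda ((P v).comp (Polynomial.C ((natGenerator v : ℕ) : PadicAlgCl p)⁻¹ * (Polynomial.X + 1)))) :=
  lambdaInvariant_quotient_span_eq_of_eulerProduct_iwasawaAlgebraO p S S₀ hc hL hle hlt P
    (fun v ↦ ((natGenerator v : ℕ) : PadicAlgCl p)⁻¹) (fun v ↦ frobeniusExponent p ((natGenerator v : ℕ) : ℤ_[p])) hP
    (fun v _ ↦ inv_natCast_natGenerator_ne_zero v) (fun v hv ↦ frobeniusExponent_natGenerator_ne_zero v (hS₀ v hv))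

end Summit.BirchSwinnertonDyer.BirchSwinnertonDyer.Theorems.SmallImageRttE2Num

end
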